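import Literature.MathematicalPhysics.QuantumManyBody.JelliumSection5Assembly
import HarnessLib

/-!
# Assembly of Lieb–Solovej §5 in first quantization, II: the `ŵ_{00,00}` group and the `ŵ_{p0,q0}` group

Topic `Literature/MathematicalPhysics/QuantumManyBody` (the charged Bose gas, `JelliumBoseGas.foldyLaw`).
Two more steps of the assembly of [LiebSolovej2001, §5] (continuous `n`-body function on `Λⁿ = cellN`,
symmetric bounded weight `0 ≤ w ≤ W_b` with row integrals `≤ M`, `m(x) = ∫_Λw(y,x)dy`, `c = ∬_{Λ²}w`):

* `toReal_lintegral_lintegral_w`, `integral_colWeight_eq` — `(∬w as ℝ≥0∞).toReal = c = ∫_Λ m`;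
* `sum_D0_eq_toReal` — **the `ŵ_{00,00}` pair group**: `∑_{i≠j}∫w|PᵢPⱼΨ|² = ℓ⁻⁶c∑_{i≠j}‖PᵢPⱼΨ‖²`
  (`JelliumLemma52.pairPP_eq` in real form), and `sum_bgPP_eq` — `∑ⱼ∫m(xⱼ)|PⱼΨ|² = ℓ⁻³c∑ⱼ‖PⱼΨ‖²`;
* `lemma53_group_lowerBound` — **the `ŵ_{p0,q0}` group**:
  `∑_{i≠j}(∫w|PᵢQⱼΨ|² + ∫w|QᵢPⱼΨ|²) - 2ρ∑ⱼ∫m(xⱼ)|QⱼΨ|² ≥ -2([ρ - nℓ⁻³]₊M⟨n̂₊⟩ + ℓ⁻³M⟨n̂₊²⟩)`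
  (`JelliumSection5Identifications.sum_D1_eq/sum_D2_eq` and `JelliumLemma53.ls_lemma53`).

## References

* [LiebSolovej2001] E. H. Lieb, J. P. Solovej, Commun. Math. Phys. 217 (2001) 127–163, Lemmas 5.2–5.3.
-/

noncomputable section

open MeasureTheory Set Filter Real
open scoped ENNReal NNReal Topology ComplexConjugate

namespace Literature.MathematicalPhysics.QuantumManyBody.JelliumBoseGas

open BoseGas

variable {n : ℕ} {ℓ : ℝ}

section Weights

variable {w : Space → Space → ℝ}

/-- The row integral `x ↦ ∫_Λ w(x,y)dy` of a bounded measurable weight: measurable, nonnegative for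
`w ≥ 0`, bounded by `W_bℓ³` (`ℓ ≥ 0`). [folklore] -/
theorem row_weight_props (hℓ : 0 ≤ ℓ) (hw : Measurable (Function.uncurry w)) (hw0 : ∀ x y, 0 ≤ w x y)
    {Wb : ℝ} (hWb : ∀ x y, |w x y| ≤ Wb) :
    Measurable (fun x => ∫ y in cell ℓ, w x y) ∧ (∀ x, 0 ≤ ∫ y in cell ℓ, w x y) ∧
      ∀ x, |∫ y in cell ℓ, w x y| ≤ Wb * ℓ ^ 3 := by
  have h := column_weight_props (w := fun x y => w y x) hℓ (hw.comp measurable_swap) (fun x y => hw0 y x)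
    (fun x y => hWb y x)
  simpa only using h

/-- `(∫⁻_Λ∫⁻_Λ ofReal w).toReal = ∫_Λ∫_Λ w` for a bounded measurable weight `w ≥ 0`. [folklore] -/
theorem toReal_lintegral_lintegral_w (hℓ : 0 ≤ ℓ) (hw : Measurable (Function.uncurry w))
    (hw0 : ∀ x y, 0 ≤ w x y) {Wb : ℝ} (hWb : ∀ x y, |w x y| ≤ Wb) :
    (∫⁻ x in cell ℓ, ∫⁻ y in cell ℓ, ENNReal.ofReal (w x y)) = ENNReal.ofReal (∫ x in cell ℓ, ∫ y in cell ℓ, w x y) := by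
  obtain ⟨hrm, hr0, hrb⟩ := row_weight_props hℓ hw hw0 hWb
  haveI := isFiniteMeasure_restrict_cell ℓ
  have hWb0 : 0 ≤ Wb := (abs_nonneg _).trans (hWb 0 0)
  have hinner : ∀ x, (∫⁻ y in cell ℓ, ENNReal.ofReal (w x y)) = ENNReal.ofReal (∫ y in cell ℓ, w x y) := by
    intro x
    have hint : IntegrableOn (fun y => w x y) (cell ℓ) :=
      integrableOn_cell_of_bounded (hw.comp (measurable_const.prodMk measurable_id)) (fun y => hWb x y) ℓ
    exact (ofReal_integral_eq_lintegral_ofReal hint (Eventually.of_forall fun y => hw0 x y)).symm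
  simp_rw [hinner]
  have hint2 : IntegrableOn (fun x => ∫ y in cell ℓ, w x y) (cell ℓ) := integrableOn_cell_of_bounded hrm hrb ℓ
  exact (ofReal_integral_eq_lintegral_ofReal hint2 (Eventually.of_forall hr0)).symm

/-- For a symmetric weight `∫_Λ m = ∫_Λ∫_Λ w` with `m` the column integral. [folklore] -/
theorem integral_colWeight_eq (hsymm : ∀ x y, w x y = w y x) :
    (∫ y in cell ℓ, ∫ y' in cell ℓ, w y' y) = ∫ x in cell ℓ, ∫ y in cell ℓ, w x y := by
  refine integral_congr_ae (Eventually.of_forall fun x => ?_)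
  refine integral_congr_ae (Eventually.of_forall fun y => ?_)
  exact hsymm y x

end Weights

/-! ### The `ŵ_{00,00}` group -/

section W00

variable {w : Space → Space → ℝ} {Ψ : Config n → ℂ}

/-- **`∑_{i≠j}∫w|PᵢPⱼΨ|² = ℓ⁻⁶c∑_{i≠j}‖PᵢPⱼΨ‖²`**, `c = ∬_{Λ²}w` (`⟨a*₀a*₀a₀a₀⟩`-terms, Lemma 5.2).
[cite: LiebSolovej2001, Lemma 5.2] -/
theorem sum_D0_eq_toReal (hℓ : 0 < ℓ) (hw : Measurable (Function.uncurry w)) (hw0 : ∀ x y, 0 ≤ w x y)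
    {Wb : ℝ} (hWb : ∀ x y, |w x y| ≤ Wb) (hΨ : Continuous Ψ) :
    ∑ i : Fin n, ∑ j ∈ Finset.univ.erase i, ∫ X in cellN n ℓ, w (X i) (X j) *
        ‖sliceMean ℓ i (sliceMean ℓ j Ψ) X‖ ^ 2 =
      (ℓ ^ 3)⁻¹ * (ℓ ^ 3)⁻¹ * (∫ x in cell ℓ, ∫ y in cell ℓ, w x y) *
        ∑ i : Fin n, ∑ j ∈ Finset.univ.erase i,
          (∫⁻ X in cellN n ℓ, (‖sliceMean ℓ i (sliceMean ℓ j Ψ) X‖₊ : ℝ≥0∞) ^ 2).toReal := by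
  obtain ⟨hrm, hr0, hrb⟩ := row_weight_props hℓ.le hw hw0 hWb
  have hwE : Measurable (Function.uncurry fun x y => ENNReal.ofReal (w x y)) := ENNReal.measurable_ofReal.comp hw
  have hc := toReal_lintegral_lintegral_w hℓ.le hw hw0 hWb
  have hc0 : 0 ≤ ∫ x in cell ℓ, ∫ y in cell ℓ, w x y := integral_nonneg hr0
  rw [Finset.mul_sum]
  refine Finset.sum_congr rfl fun i _ => ?_
  rw [Finset.mul_sum]
  refine Finset.sum_congr rfl fun j hj => ?_
  have hij : i ≠ j := (Finset.ne_of_mem_erase hj).symm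
  rw [diag_block_eq_toReal hw hw0 hWb i j (continuous_sliceMean ℓ i (continuous_sliceMean ℓ j hΨ)),
    pairPP_eq hℓ hij hwE hΨ, hc, ENNReal.toReal_mul, ENNReal.toReal_mul, ENNReal.toReal_mul,
    ENNReal.toReal_inv, ENNReal.toReal_pow, ENNReal.toReal_ofReal hℓ.le, ENNReal.toReal_ofReal hc0]

/-- **`∑ⱼ∫m(xⱼ)|PⱼΨ|² = ℓ⁻³c∑ⱼ‖PⱼΨ‖²`** with `m(x) = ∫_Λw(y,x)dy`, `c = ∬w` (symmetric `w`;
`⟨a*₀a₀⟩`-terms). [cite: LiebSolovej2001, Lemma 5.2] -/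
theorem sum_bgPP_eq (hℓ : 0 < ℓ) (hw : Measurable (Function.uncurry w)) (hw0 : ∀ x y, 0 ≤ w x y)
    {Wb : ℝ} (hWb : ∀ x y, |w x y| ≤ Wb) (hsymm : ∀ x y, w x y = w y x) (hΨ : Continuous Ψ) :
    ∑ j : Fin n, ∫ X in cellN n ℓ, (∫ y in cell ℓ, w y (X j)) * ‖sliceMean ℓ j Ψ X‖ ^ 2 =
      (ℓ ^ 3)⁻¹ * (∫ x in cell ℓ, ∫ y in cell ℓ, w x y) *
        ∑ j : Fin n, (∫⁻ X in cellN n ℓ, (‖sliceMean ℓ j Ψ X‖₊ : ℝ≥0∞) ^ 2).toReal := by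
  obtain ⟨hmm, hm0, hmb⟩ := column_weight_props hℓ.le hw hw0 hWb
  rw [Finset.mul_sum, ← integral_colWeight_eq hsymm]
  refine Finset.sum_congr rfl fun j _ => ?_
  exact background_PP_eq hℓ hmm hm0 hmb j hΨ

end W00

/-! ### The `ŵ_{p0,q0}` group -/

section W0q

variable {w : Space → Space → ℝ} {Ψ : Config n → ℂ}

/-- **The `ŵ_{p0,q0}` group** [LiebSolovej2001, Lemma 5.3 applied to the blocks]: for `ℓ > 0`, a
symmetric bounded measurable weight `0 ≤ w ≤ W_b` with row integrals `≤ M < ∞` (as `ℝ≥0∞` integrals of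
`ofReal w`), `m(x) = ∫_Λ w(y,x)dy`, continuous `Ψ` and `ρ ∈ ℝ`:
`∑ᵢ∑_{j≠i}(∫w|PᵢQⱼΨ|² + ∫w|QᵢPⱼΨ|²) - 2ρ∑ⱼ∫m(xⱼ)|QⱼΨ|²
  ≥ -2([ρ - nℓ⁻³]₊ M ⟨n̂₊⟩ + ℓ⁻³M⟨n̂₊²⟩)`, `⟨n̂₊⟩ = ∑‖QᵢΨ‖²`, `⟨n̂₊²⟩ = ⟨n̂₊⟩ + ∑_{i≠j}‖QⱼQᵢΨ‖²`.
[cite: LiebSolovej2001, Lemma 5.3] -/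
theorem lemma53_group_lowerBound (hℓ : 0 < ℓ) (hw : Measurable (Function.uncurry w))
    (hw0 : ∀ x y, 0 ≤ w x y) {Wb : ℝ} (hWb : ∀ x y, |w x y| ≤ Wb) (hsymm : ∀ x y, w x y = w y x)
    {M : ℝ≥0∞} (hM : M ≠ ⊤) (hrow : ∀ x, ∫⁻ y in cell ℓ, ENNReal.ofReal (w x y) ≤ M)
    (hΨ : Continuous Ψ) (ρ : ℝ) :
    -(2 * (max (ρ - n / ℓ ^ 3) 0 * M.toReal *
          (∑ i : Fin n, ∫⁻ X in cellN n ℓ, (‖sliceFluct ℓ i Ψ X‖₊ : ℝ≥0∞) ^ 2).toReal +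
        (ℓ ^ 3)⁻¹ * M.toReal *
          ((∑ i : Fin n, ∫⁻ X in cellN n ℓ, (‖sliceFluct ℓ i Ψ X‖₊ : ℝ≥0∞) ^ 2) +
            ∑ i : Fin n, ∑ j ∈ Finset.univ.erase i,
              ∫⁻ X in cellN n ℓ, (‖sliceFluct ℓ j (sliceFluct ℓ i Ψ) X‖₊ : ℝ≥0∞) ^ 2).toReal)) ≤
      (∑ i : Fin n, ∑ j ∈ Finset.univ.erase i,
        ((∫ X in cellN n ℓ, w (X i) (X j) * ‖sliceMean ℓ i (sliceFluct ℓ j Ψ) X‖ ^ 2) +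
          ∫ X in cellN n ℓ, w (X i) (X j) * ‖sliceFluct ℓ i (sliceMean ℓ j Ψ) X‖ ^ 2)) -
        2 * ρ * ∑ j : Fin n, ∫ X in cellN n ℓ, (∫ y in cell ℓ, w y (X j)) * ‖sliceFluct ℓ j Ψ X‖ ^ 2 := by
  obtain ⟨hmm, hm0, hmb⟩ := column_weight_props hℓ.le hw hw0 hWb
  set wE : Space → Space → ℝ≥0∞ := fun x y => ENNReal.ofReal (w x y) with hwE
  have hwEm : Measurable (Function.uncurry wE) := ENNReal.measurable_ofReal.comp hw
  have hwEsymm : ∀ x y, wE x y = wE y x := fun x y => by simp only [hwE, hsymm x y]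
  -- the `ℝ≥0∞` column weight and its identification with `ofReal ∘ m`
  set mE : Space → ℝ≥0∞ := fun x => ∫⁻ y in cell ℓ, wE y x with hmE
  have hmEm : Measurable mE := (hwEm.comp measurable_swap).lintegral_prod_right'
  have hmEeq : ∀ x, mE x = ENNReal.ofReal (∫ y in cell ℓ, w y x) := by
    intro x
    have hint : IntegrableOn (fun y => w y x) (cell ℓ) :=
      integrableOn_cell_of_bounded (hw.comp (measurable_id.prodMk measurable_const)) (fun y => hWb y x) ℓ
    exact (ofReal_integral_eq_lintegral_ofReal hint (Eventually.of_forall fun y => hw0 y x)).symm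
  have hMr : 0 ≤ M.toReal := ENNReal.toReal_nonneg
  have hmle : ∀ x, mE x ≤ ENNReal.ofReal M.toReal := fun x => by
    rw [ENNReal.ofReal_toReal hM]
    exact col_bound_of_symm hsymm hrow x
  -- Lemma 5.3 with the weight `mE`
  have h53 := ls_lemma53 hℓ hΨ hmEm hMr hmle ρ
  -- identify `∑D₁`, `∑D₂` with `ℓ⁻³B` and `∑bgQQ` with `A`
  have hfinD : ∀ (i j : Fin n) (F : Config n → ℂ), Continuous F →
      (∫⁻ X in cellN n ℓ, wE (X i) (X j) * (‖F X‖₊ : ℝ≥0∞) ^ 2) ≠ ⊤ := by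
    intro i j F hF
    have hWb0 : 0 ≤ Wb := (abs_nonneg _).trans (hWb 0 0)
    have h := setLIntegral_cellN_weight_normSq_lt_top hF ℓ (m := fun _ : Space => ENNReal.ofReal Wb)
      ENNReal.ofReal_ne_top (fun _ => le_rfl) i
    refine ne_top_of_le_ne_top h.ne (lintegral_mono fun X => mul_le_mul' ?_ le_rfl)
    exact ENNReal.ofReal_le_ofReal ((le_abs_self _).trans (hWb _ _))
  have hD1 : ∑ i : Fin n, ∑ j ∈ Finset.univ.erase i, ∫ X in cellN n ℓ, w (X i) (X j) *
      ‖sliceMean ℓ i (sliceFluct ℓ j Ψ) X‖ ^ 2 =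
      (ℓ ^ 3)⁻¹ * (∑ i : Fin n, ∑ j ∈ Finset.univ.erase i,
        ∫⁻ X in cellN n ℓ, mE (X i) * (‖sliceMean ℓ j (sliceFluct ℓ i Ψ) X‖₊ : ℝ≥0∞) ^ 2).toReal := by
    have h := congrArg ENNReal.toReal (sum_D1_eq (wE := wE) hℓ hwEm hΨ)
    rw [ENNReal.toReal_mul, ENNReal.toReal_inv, ENNReal.toReal_pow, ENNReal.toReal_ofReal hℓ.le,
      ENNReal.toReal_sum (fun i _ => ENNReal.sum_ne_top.2 fun j _ =>
        hfinD i j _ (continuous_sliceMean ℓ i (continuous_sliceFluct ℓ j hΨ)))] at h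
    rw [← h]
    refine Finset.sum_congr rfl fun i _ => ?_
    rw [ENNReal.toReal_sum (fun j _ => hfinD i j _ (continuous_sliceMean ℓ i (continuous_sliceFluct ℓ j hΨ)))]
    refine Finset.sum_congr rfl fun j _ => ?_
    exact diag_block_eq_toReal hw hw0 hWb i j (continuous_sliceMean ℓ i (continuous_sliceFluct ℓ j hΨ))
  have hD2 : ∑ i : Fin n, ∑ j ∈ Finset.univ.erase i, ∫ X in cellN n ℓ, w (X i) (X j) *
      ‖sliceFluct ℓ i (sliceMean ℓ j Ψ) X‖ ^ 2 =
      (ℓ ^ 3)⁻¹ * (∑ i : Fin n, ∑ j ∈ Finset.univ.erase i,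
        ∫⁻ X in cellN n ℓ, mE (X i) * (‖sliceMean ℓ j (sliceFluct ℓ i Ψ) X‖₊ : ℝ≥0∞) ^ 2).toReal := by
    have h := congrArg ENNReal.toReal (sum_D2_eq (wE := wE) hℓ hwEm hwEsymm hΨ)
    rw [ENNReal.toReal_mul, ENNReal.toReal_inv, ENNReal.toReal_pow, ENNReal.toReal_ofReal hℓ.le,
      ENNReal.toReal_sum (fun i _ => ENNReal.sum_ne_top.2 fun j _ =>
        hfinD i j _ (continuous_sliceFluct ℓ i (continuous_sliceMean ℓ j hΨ)))] at h
    rw [← h]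
    refine Finset.sum_congr rfl fun i _ => ?_
    rw [ENNReal.toReal_sum (fun j _ => hfinD i j _ (continuous_sliceFluct ℓ i (continuous_sliceMean ℓ j hΨ)))]
    refine Finset.sum_congr rfl fun j _ => ?_
    exact diag_block_eq_toReal hw hw0 hWb i j (continuous_sliceFluct ℓ i (continuous_sliceMean ℓ j hΨ))
  have hA : ∑ j : Fin n, ∫ X in cellN n ℓ, (∫ y in cell ℓ, w y (X j)) * ‖sliceFluct ℓ j Ψ X‖ ^ 2 =
      (∑ i : Fin n, ∫⁻ X in cellN n ℓ, mE (X i) * (‖sliceFluct ℓ i Ψ X‖₊ : ℝ≥0∞) ^ 2).toReal := by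
    have hfinA : ∀ i : Fin n, (∫⁻ X in cellN n ℓ, mE (X i) * (‖sliceFluct ℓ i Ψ X‖₊ : ℝ≥0∞) ^ 2) ≠ ⊤ :=
      fun i => (setLIntegral_cellN_weight_normSq_lt_top (continuous_sliceFluct ℓ i hΨ) ℓ
        ENNReal.ofReal_ne_top hmle i).ne
    rw [ENNReal.toReal_sum (fun i _ => hfinA i)]
    refine Finset.sum_congr rfl fun j _ => ?_
    rw [diag_background_eq_toReal hmm hm0 hmb j (continuous_sliceFluct ℓ j hΨ)]
    congr 1
    refine lintegral_congr fun X => ?_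
    rw [hmEeq]
  rw [Finset.sum_congr rfl fun i _ => Finset.sum_add_distrib, Finset.sum_add_distrib, hD1, hD2, hA]
  linarith [h53]

end W0q

end Literature.MathematicalPhysics.QuantumManyBody.JelliumBoseGas
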